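import Literature.MathematicalPhysics.QuantumFieldTheory.Balaban1983to89.BlockAveragingFederbush

/-!
# THE `SU(N)` RADIUS OF FEDERBUSH'S IMPLICIT AVERAGE (0.10) of [Balaban1987RG1]: the `1/N` is NECESSARY
# (kernel-checked witness for the construction of `BlockAveragingFederbush`), and (0.10) is `SL(N,ℂ)`-valued

T. Bałaban, *Renormalization group approach to lattice gauge field theories. I*, Comm. Math. Phys. **109** (1987)
249–301 (`Balaban1987RG1`, "B12"), §0 p. 253 — the locus of the construction this file is about (quotations repeated
from the header of `BlockAveragingFederbush`, whose loci were certified in the audit cells C-pv26g2-4, C-pv26g3-2,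
C-ref5-78 of the programme that commissioned both files; nothing new is quoted here):

«The average of the set {U_j} is the element U ∈ Gᶜ such that U_j are in a small neighborhood of U, and it satisfies
the equation Σ_{j=1}^{n} (1/i) log U_j U⁻¹ = 0. (0.10)»  and, among "the properties listed above" on the same page,
«if U_j ∈ G, then M({U_j}) ∈ G also. (0.9)».

## What this file PROVES (nothing printed is asserted; every statement is about the tree's construction)

The module `BlockAveragingFederbush` constructs the solution `X = fedSol W` of (0.10) for families `W_j` with
`‖W_j − 1‖ ≤ 1/100` in any complete normed `ℂ`-algebra, the group average `fedM δ U = X* U₀` on matrix families, and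
the inhabitants `federbushU : GroupAverage U(N)` (radius `1/100`, uniform in `N`) and `federbushSU : GroupAverage SU(N)`
(radius `δ_N = min(1/100, 1/(3N))`); its §3 proves (0.9) on `SU(N)` — `det X = 1` — under `N·δ ≤ 1/3` and records, as
NOT formalised, that "the `1/N` in the radius cannot be removed".  This file supplies the kernel-checked witness and
the exact numbers (`N = |n|`, `L²`-operator norm, `log` = the series (21) `MatrixLog.mlog`):

* §1 scalar matrices: `e^c·1 = exp (c·1)`, `‖c·1 − 1‖ = |c − 1|`, and `log (e^z·1) = z·1` for `|z| < ln 2`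
  (`mlog_cexp_smul_one`, via the tree's `B7BlockAvgLog.mlog_exp`).
* §2 THE ROOT PAIR `U = (1, ζ_N·1)`, `ζ_N = e^{2πi/N}` — an `SU(N)`-valued pair (`rootPair_mem_specialUnitaryGroup`)
  whose guard `‖U_i U_k* − 1‖ < δ` holds IFF `2 sin(π/N) < δ` (`rootPair_small_iff`, since `|ζ_N − 1| = 2 sin(π/N)`,
  `norm_zeta_sub_one`).  For `N ≥ 2` and `2 sin(π/N) ≤ 1/100` the solution of (0.10) for this pair is the scalar
  `e^{−iπ/N}·1` (`fedSol_rootPair`: it solves the equation — `log (e^{∓iπ/N}·1) = ∓(iπ/N)·1` sum to zero — and lies in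
  the uniqueness ball of `fedSol_unique`), hence AT EVERY RADIUS `δ > 2 sin(π/N)` (every `δ` at which the pair passes
  the guard; in particular every `δ ∈ (2 sin(π/N), 1/100]`): `fedM δ U = e^{iπ/N}·1` (`fedM_rootPair`),
  `det (fedM δ U) = e^{iπ} = −1` (`det_fedM_rootPair`), and `fedM δ U ∉ SU(N)`
  (`fedM_rootPair_not_mem_specialUnitaryGroup`).
  §2b the numeric threshold: `2 sin(π/N) < 1/100` for `N ≥ 629` and `1/100 < 2 sin(π/N)` for `2 ≤ N ≤ 628`
  (`two_mul_sin_pi_div_lt`, `lt_two_mul_sin_pi_div`; Mathlib's decimal bounds on `π`, `sin x < x`, `x − x³/6 < sin x`),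
  so `N ≥ 2 ∧ 2 sin(π/N) ≤ 1/100 ⇔ N ≥ 629`.
  The `SU(N)` inhabitant's own guard excludes the pair at every `N ≥ 2` (`rootPair_not_small_deltaFed`:
  `δ_N ≤ 1/(3N) < 4/N ≤ 2 sin(π/N)` by Jordan's inequality).
* §3 GROUP LEVEL: for every `N ≥ 629` the `U(N)`-inhabitant `federbushU` (radius `1/100`) maps the `1/100`-small,
  `SU(N)`-VALUED pair `rootPairU` to `e^{iπ/N}·1`, of determinant `−1`, OUTSIDE `SU(N)` (`coe_federbushU_rootPairU`,
  `det_federbushU_rootPairU`, `federbushU_rootPairU_not_mem`, packaged as `federbushU_not_specialUnitary_valued`).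
  Consequently NO `N`-uniform radius makes this construction `SU(N)`-valued on `SU(N)`-families for all `N`: the
  largest radius `δ*(N)` below which `fedM δ` is `SU(N)`-valued on `SU(N)`-families satisfies
  `min(1/100, 1/(3N)) ≤ δ*(N)` (`BlockAveragingFederbush.fedM_mem_specialUnitaryGroup`) and, for `N ≥ 629`,
  `δ*(N) ≤ 2 sin(π/N) < 2π/N` (this file) — the ORDER `1/N` of `federbushSU`'s radius is sharp; the constant in
  `[1/3, 2π]` is not determined here (`two_sided_radius` states both sides).
* §4 (0.10) IS `SL(N,ℂ)`-VALUED (`Gᶜ` for `G = SU(N)`) at the solution level: for every `M_N(ℂ)`-family with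
  `det W_j = 1`, `‖W_j − 1‖ ≤ δ ≤ 1/100` and `N·δ ≤ 1/3`, `det (fedSol W) = 1` (`det_fedSol_eq_one_of_det_eq_one` — the
  argument of `BlockAveragingFederbush.det_fedSol_eq_one` verbatim, which uses of its `SU(N)` hypothesis only
  `det W_j = 1`; that theorem is the special case `W_j ∈ SU(N)` and is not restated).

## What is NOT encoded

* Whether `SU(N)`-valuedness fails for SOME `SU(N)`-family at radii between `1/(3N)` and `2 sin(π/N)`, or at the
  radius `1/100` for `34 ≤ N ≤ 628`, is not decided (the witness is the scalar pair only; at radii `> 1/100` the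
  tree's `fedSol` is not constructed, so nothing is claimed there).
* Nothing here is a statement of print: B12 asserts (0.9) for "sufficiently small diameters" without a rate in `N`;
  the numbers `1/100`, `1/(3N)`, `2 sin(π/N)`, `629` are the FILES'.

Model conventions: `[cite: Balaban1987RG1, (0.10) p.253]` sits only on §4's theorem (print's "the element U ∈ Gᶜ"
for `G = SU(N)`, verified for the constructed solution); everything else is `[folklore]` (explicit computation with
scalar matrices + the tree's uniqueness theorem `fedSol_unique`).
-/

noncomputable section

open NormedSpace Metric Set
open scoped NNReal

namespace Literature.MathematicalPhysics.QuantumFieldTheory.Balaban1983to89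

namespace FederbushMean

open MatrixLog ExpMeanLog
open B7BlockAvgLog (mlog_exp)
open Literature.Analysis.Matrix (det_exp_eq_exp_trace)
open scoped Matrix.Norms.L2Operator ComplexConjugate

/-! ## 1. Scalar matrices: `exp`, the norm, and the series logarithm (21) -/

section Scalar

variable {n : Type*} [Fintype n] [DecidableEq n]

/-- `e^c·1 = exp (c·1)` in `M_N(ℂ)` (any `N`, any index type). [folklore] -/
theorem cexp_smul_one (c : ℂ) : Complex.exp c • (1 : Matrix n n ℂ) = exp (c • (1 : Matrix n n ℂ)) := by
  rw [← Algebra.algebraMap_eq_smul_one, ← Algebra.algebraMap_eq_smul_one, Complex.exp_eq_exp_ℂ]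
  exact algebraMap_exp_comm (𝔸 := Matrix n n ℂ) c

/-- Scalar matrices multiply as scalars: `(a·1)(b·1)* = (a b̄)·1`. [folklore] -/
theorem smul_one_mul_star_smul_one (a b : ℂ) :
    a • (1 : Matrix n n ℂ) * star (b • (1 : Matrix n n ℂ)) = (a * conj b) • (1 : Matrix n n ℂ) := by
  rw [star_smul, star_one, smul_mul_assoc, one_mul, smul_smul, Complex.star_def]

variable [Nonempty n]

/-- `‖c·1‖ = |c|` (`L²`-operator norm, `N ≥ 1`). [folklore] -/
theorem norm_smul_one_eq (c : ℂ) : ‖c • (1 : Matrix n n ℂ)‖ = ‖c‖ := by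
  rw [norm_smul, CStarRing.norm_one, mul_one]

/-- `‖c·1 − 1‖ = |c − 1|` (`L²`-operator norm, `N ≥ 1`). [folklore] -/
theorem norm_smul_one_sub_one (c : ℂ) : ‖c • (1 : Matrix n n ℂ) - 1‖ = ‖c - 1‖ := by
  rw [show c • (1 : Matrix n n ℂ) - 1 = (c - 1) • (1 : Matrix n n ℂ) by rw [sub_smul, one_smul], norm_smul_one_eq]

/-- **The series logarithm (21) of a scalar matrix near `1`**: `log (e^z·1) = z·1` for `|z| < ln 2`. [folklore] -/
theorem mlog_cexp_smul_one {z : ℂ} (hz : ‖z‖ < Real.log 2) :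
    mlog (Complex.exp z • (1 : Matrix n n ℂ)) = z • (1 : Matrix n n ℂ) := by
  letI : NormedAlgebra ℚ (Matrix n n ℂ) := NormedAlgebra.restrictScalars ℚ ℂ _
  rw [cexp_smul_one]
  exact mlog_exp (by rwa [norm_smul_one_eq])

end Scalar

/-! ## 2. The root pair `(1, e^{2πi/N}·1)`: its implicit mean is `e^{iπ/N}·1`, of determinant `−1` -/

section RootPair

variable {n : Type*} [Fintype n] [DecidableEq n]

/-- `ζ_N = e^{2πi/N}`, `N = |n|`. [folklore] -/
def zeta (n : Type*) [Fintype n] : ℂ := Complex.exp (((2 * Real.pi / Fintype.card n : ℝ) : ℂ) * Complex.I)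

/-- `η_N = e^{iπ/N}` (so `η_N² = ζ_N`, `η_N^N = −1`), `N = |n|`. [folklore] -/
def halfRoot (n : Type*) [Fintype n] : ℂ := Complex.exp (((Real.pi / Fintype.card n : ℝ) : ℂ) * Complex.I)

/-- **The root pair** `U₀ = 1`, `U₁ = ζ_N·1` (`U_j = ζ_N^j·1`). [folklore] -/
def rootPair (n : Type*) [Fintype n] [DecidableEq n] : Fin 2 → Matrix n n ℂ := fun j => zeta n ^ (j : ℕ) • 1

omit [DecidableEq n] in
/-- `|ζ_N| = 1`. [folklore] -/
theorem norm_zeta : ‖zeta n‖ = 1 := Complex.norm_exp_ofReal_mul_I _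

omit [DecidableEq n] in
/-- `ζ_N ζ̄_N = 1`. [folklore] -/
theorem zeta_mul_conj : zeta n * conj (zeta n) = 1 := by
  rw [Complex.mul_conj, Complex.normSq_eq_norm_sq, norm_zeta]; simp

omit [DecidableEq n] in
/-- `|η_N| = 1`. [folklore] -/
theorem norm_halfRoot : ‖halfRoot n‖ = 1 := Complex.norm_exp_ofReal_mul_I _

omit [DecidableEq n] in
/-- `ζ_N^N = 1`. [folklore] -/
theorem zeta_pow_card [Nonempty n] : zeta n ^ Fintype.card n = 1 := by
  have hN0 : (Fintype.card n : ℂ) ≠ 0 := Nat.cast_ne_zero.mpr Fintype.card_ne_zero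
  rw [zeta, ← Complex.exp_nat_mul]
  have : (Fintype.card n : ℂ) * (((2 * Real.pi / Fintype.card n : ℝ) : ℂ) * Complex.I) = 2 * Real.pi * Complex.I := by
    push_cast; field_simp
  rw [this, Complex.exp_two_pi_mul_I]

omit [DecidableEq n] in
/-- `η_N^N = −1`. [folklore] -/
theorem halfRoot_pow_card [Nonempty n] : halfRoot n ^ Fintype.card n = -1 := by
  have hN0 : (Fintype.card n : ℂ) ≠ 0 := Nat.cast_ne_zero.mpr Fintype.card_ne_zero
  rw [halfRoot, ← Complex.exp_nat_mul]
  have : (Fintype.card n : ℂ) * (((Real.pi / Fintype.card n : ℝ) : ℂ) * Complex.I) = Real.pi * Complex.I := by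
    push_cast; field_simp
  rw [this, Complex.exp_pi_mul_I]

omit [DecidableEq n] in
/-- `ζ_N η̄_N = η_N` (`e^{2iθ} e^{−iθ} = e^{iθ}`). [folklore] -/
theorem zeta_mul_conj_halfRoot : zeta n * conj (halfRoot n) = halfRoot n := by
  rw [zeta, halfRoot, ← Complex.exp_conj, ← Complex.exp_add]
  congr 1
  simp only [map_mul, Complex.conj_ofReal, Complex.conj_I]
  push_cast
  ring

omit [DecidableEq n] in
/-- `η̄_N = e^{−iπ/N}` as an exponential. [folklore] -/
theorem conj_halfRoot : conj (halfRoot n) = Complex.exp (-(((Real.pi / Fintype.card n : ℝ) : ℂ) * Complex.I)) := by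
  rw [halfRoot, ← Complex.exp_conj]
  congr 1
  simp only [map_mul, Complex.conj_ofReal, Complex.conj_I]
  ring

omit [DecidableEq n] in
/-- **`|ζ_N − 1| = 2 sin(π/N)`.** [folklore] -/
theorem norm_zeta_sub_one [Nonempty n] : ‖zeta n - 1‖ = 2 * Real.sin (Real.pi / Fintype.card n) := by
  have hN : (0 : ℝ) < Fintype.card n := Nat.cast_pos.mpr Fintype.card_pos
  rw [zeta, mul_comm, Complex.norm_exp_I_mul_ofReal_sub_one,
    show 2 * Real.pi / Fintype.card n / 2 = Real.pi / Fintype.card n by ring, Real.norm_of_nonneg]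
  refine mul_nonneg (by norm_num) (Real.sin_nonneg_of_nonneg_of_le_pi (by positivity) ?_)
  exact div_le_self Real.pi_pos.le (by exact_mod_cast Fintype.card_pos)

omit [DecidableEq n] in
/-- `|η̄_N − 1| ≤ π/N`. [folklore] -/
theorem norm_conj_halfRoot_sub_one_le [Nonempty n] : ‖conj (halfRoot n) - 1‖ ≤ Real.pi / Fintype.card n := by
  have hN : (0 : ℝ) < Fintype.card n := Nat.cast_pos.mpr Fintype.card_pos
  rw [conj_halfRoot, show -(((Real.pi / Fintype.card n : ℝ) : ℂ) * Complex.I) =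
    Complex.I * ((-(Real.pi / Fintype.card n) : ℝ) : ℂ) by push_cast; ring]
  refine (Real.norm_exp_I_mul_ofReal_sub_one_le).trans (le_of_eq ?_)
  rw [norm_neg, Real.norm_of_nonneg (by positivity)]

/-- `U₀ = 1`. [folklore] -/
@[simp] theorem rootPair_zero : rootPair n 0 = 1 := by simp [rootPair]

/-- `U₁ = ζ_N·1`. [folklore] -/
@[simp] theorem rootPair_one : rootPair n 1 = zeta n • 1 := by simp [rootPair]

/-- `ζ_N·1 ∈ SU(N)` (`N ≥ 1`). [folklore] -/
theorem zeta_smul_one_mem_specialUnitaryGroup [Nonempty n] :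
    zeta n • (1 : Matrix n n ℂ) ∈ Matrix.specialUnitaryGroup n ℂ := by
  rw [Matrix.mem_specialUnitaryGroup_iff, Matrix.mem_unitaryGroup_iff, Matrix.det_smul, Matrix.det_one, mul_one,
    zeta_pow_card, smul_one_mul_star_smul_one, zeta_mul_conj, one_smul]
  exact ⟨rfl, rfl⟩

/-- **The root pair is `SU(N)`-valued.** [folklore] -/
theorem rootPair_mem_specialUnitaryGroup [Nonempty n] (j : Fin 2) : rootPair n j ∈ Matrix.specialUnitaryGroup n ℂ := by
  revert j
  refine Fin.forall_fin_two.2 ⟨?_, ?_⟩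
  · rw [rootPair_zero]; exact Submonoid.one_mem _
  · rw [rootPair_one]; exact zeta_smul_one_mem_specialUnitaryGroup

/-- The four quotients of the root pair: `‖U_i U_k* − 1‖ = |ζ^i ζ̄^k − 1|`. [folklore] -/
theorem norm_rootPair_mul_star_sub_one [Nonempty n] (i k : Fin 2) :
    ‖rootPair n i * star (rootPair n k) - 1‖ = ‖zeta n ^ (i : ℕ) * conj (zeta n) ^ (k : ℕ) - 1‖ := by
  rw [rootPair, rootPair, smul_one_mul_star_smul_one, map_pow, norm_smul_one_sub_one]

/-- **The guard of `fedM δ` holds on the root pair iff `2 sin(π/N) < δ`.** [folklore] -/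
theorem rootPair_small_iff [Nonempty n] {δ : ℝ} :
    (∀ i k : Fin 2, ‖rootPair n i * star (rootPair n k) - 1‖ < δ) ↔ 2 * Real.sin (Real.pi / Fintype.card n) < δ := by
  have h10 : ‖rootPair n 1 * star (rootPair n 0) - 1‖ = 2 * Real.sin (Real.pi / Fintype.card n) := by
    rw [norm_rootPair_mul_star_sub_one, ← norm_zeta_sub_one]; simp
  have h01 : ‖rootPair n 0 * star (rootPair n 1) - 1‖ = 2 * Real.sin (Real.pi / Fintype.card n) := by
    rw [norm_rootPair_mul_star_sub_one, ← norm_zeta_sub_one, ← Complex.norm_conj (zeta n - 1)]; simp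
  have hdiag : ∀ i : Fin 2, ‖rootPair n i * star (rootPair n i) - 1‖ = 0 := by
    intro i
    rw [norm_rootPair_mul_star_sub_one, ← mul_pow, zeta_mul_conj, one_pow, sub_self, norm_zero]
  constructor
  · intro h; rw [← h10]; exact h 1 0
  · intro h
    have h0 : (0 : ℝ) < δ :=
      lt_of_le_of_lt (by rw [← norm_zeta_sub_one (n := n)]; exact norm_nonneg _) h
    refine Fin.forall_fin_two.2 ⟨Fin.forall_fin_two.2 ⟨?_, ?_⟩, Fin.forall_fin_two.2 ⟨?_, ?_⟩⟩
    · rw [hdiag]; exact h0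
    · rw [h01]; exact h
    · rw [h10]; exact h
    · rw [hdiag]; exact h0

/-- The relative family of the root pair at the base point `0` is the pair itself (`U₀ = 1`). [folklore] -/
theorem rel_rootPair : rel (rootPair n) 0 = rootPair n := by
  funext j; rw [rel_apply, rootPair_zero, star_one, mul_one]

omit [DecidableEq n] in
/-- From `2 sin(π/N) ≤ 1/100` and `N ≥ 2`: `π/N ≤ 1/100` (Jordan's inequality `(2/π)x ≤ sin x` on `[0, π/2]`).
[folklore] -/
theorem pi_div_card_le [Nonempty n] (hN : 2 ≤ Fintype.card n) (h : 2 * Real.sin (Real.pi / Fintype.card n) ≤ 1 / 100) :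
    Real.pi / Fintype.card n ≤ 1 / 100 := by
  have hNr : (2 : ℝ) ≤ Fintype.card n := by exact_mod_cast hN
  have hNpos : (0 : ℝ) < Fintype.card n := by linarith
  have hx0 : 0 ≤ Real.pi / Fintype.card n := by positivity
  have hx1 : Real.pi / Fintype.card n ≤ Real.pi / 2 := div_le_div_of_nonneg_left Real.pi_pos.le (by norm_num) hNr
  have hJ := Real.mul_le_sin hx0 hx1
  have h2 : 2 / Real.pi * (Real.pi / Fintype.card n) = 2 / Fintype.card n := by
    field_simp
  rw [h2] at hJ
  -- `2/N ≤ sin(π/N) ≤ 1/200`, so `N ≥ 400` and `π/N ≤ π/400 < 1/100`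
  have hN400 : (400 : ℝ) ≤ Fintype.card n := by
    have : 2 / (Fintype.card n : ℝ) ≤ 1 / 200 := by linarith
    rw [div_le_iff₀ hNpos] at this; linarith
  rw [div_le_iff₀ hNpos]
  have := Real.pi_lt_d2
  nlinarith

/-- **The solution of (0.10) for the root pair is the scalar `e^{−iπ/N}·1`** (`N ≥ 2`, `2 sin(π/N) ≤ 1/100`): it solves
`log (e^{−iπ/N}·1) + log (e^{iπ/N}·1) = 0` and lies in the uniqueness ball `‖· − 1‖ ≤ 2/25` of `fedSol_unique`.
[folklore] -/
theorem fedSol_rootPair [Nonempty n] (hN : 2 ≤ Fintype.card n)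
    (h : 2 * Real.sin (Real.pi / Fintype.card n) ≤ 1 / 100) :
    fedSol (rel (rootPair n) 0) = conj (halfRoot n) • (1 : Matrix n n ℂ) := by
  have hθ : Real.pi / Fintype.card n ≤ 1 / 100 := pi_div_card_le hN h
  have hNpos : (0 : ℝ) < Fintype.card n := Nat.cast_pos.mpr Fintype.card_pos
  have hlog2 := Real.log_two_gt_d9
  have hθnorm : ‖((Real.pi / Fintype.card n : ℝ) : ℂ) * Complex.I‖ = Real.pi / Fintype.card n := by
    rw [norm_mul, Complex.norm_I, mul_one, Complex.norm_real, Real.norm_of_nonneg (by positivity)]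
  rw [rel_rootPair]
  have hW : ∀ j, ‖rootPair n j - 1‖ ≤ 1 / 100 := by
    intro j; fin_cases j
    · simp
    · simpa [norm_smul_one_sub_one, norm_zeta_sub_one] using h
  have hY : ‖conj (halfRoot n) • (1 : Matrix n n ℂ) - 1‖ ≤ 2 / 25 := by
    rw [norm_smul_one_sub_one]; exact norm_conj_halfRoot_sub_one_le.trans (hθ.trans (by norm_num))
  refine (fedSol_unique hW hY ?_).symm
  -- the equation: `log (η̄·1) = −(iπ/N)·1`, `log (ζ η̄·1) = log (η·1) = (iπ/N)·1`
  have h1 : mlog (conj (halfRoot n) • (1 : Matrix n n ℂ)) =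
      (-(((Real.pi / Fintype.card n : ℝ) : ℂ) * Complex.I)) • 1 := by
    rw [conj_halfRoot]; exact mlog_cexp_smul_one (by rw [norm_neg, hθnorm]; linarith)
  have h2 : mlog (zeta n • (1 : Matrix n n ℂ) * (conj (halfRoot n) • 1)) =
      (((Real.pi / Fintype.card n : ℝ) : ℂ) * Complex.I) • 1 := by
    rw [smul_mul_assoc, one_mul, smul_smul, zeta_mul_conj_halfRoot, halfRoot]
    exact mlog_cexp_smul_one (by rw [hθnorm]; linarith)
  rw [fed_def, Fin.sum_univ_two, rootPair_zero, rootPair_one, one_mul, h1, h2, ← add_smul, neg_add_cancel, zero_smul,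
    smul_zero]

variable {δ : ℝ}

/-- **The implicit mean of the root pair is `e^{iπ/N}·1` at EVERY radius `δ > 2 sin(π/N)`** (i.e. whenever the pair
passes the guard of `fedM δ`), provided `N ≥ 2` and `2 sin(π/N) ≤ 1/100` (equivalently `N ≥ 629`, §2b) so that the
pair lies in the domain of the tree's `fedSol`. [folklore] -/
theorem fedM_rootPair [Nonempty n] (hN : 2 ≤ Fintype.card n) (h100 : 2 * Real.sin (Real.pi / Fintype.card n) ≤ 1 / 100)
    (h : 2 * Real.sin (Real.pi / Fintype.card n) < δ) : fedM δ (rootPair n) = halfRoot n • (1 : Matrix n n ℂ) := by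
  rw [fedM_of_small (rootPair_small_iff.2 h), fedSol_rootPair hN h100, rootPair_zero, mul_one, star_smul, star_one,
    Complex.star_def, Complex.conj_conj]

/-- **Its determinant is `−1`.** [folklore] -/
theorem det_fedM_rootPair [Nonempty n] (hN : 2 ≤ Fintype.card n)
    (h100 : 2 * Real.sin (Real.pi / Fintype.card n) ≤ 1 / 100) (h : 2 * Real.sin (Real.pi / Fintype.card n) < δ) :
    (fedM δ (rootPair n)).det = -1 := by
  rw [fedM_rootPair hN h100 h, Matrix.det_smul, Matrix.det_one, mul_one, halfRoot_pow_card]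

/-- **TIGHTNESS OF THE `1/N` RADIUS: the implicit mean of the `SU(N)`-valued root pair is NOT in `SU(N)`** at every
radius `δ > 2 sin(π/N)` at which the pair passes the guard (`N ≥ 2`, `2 sin(π/N) ≤ 1/100`). [folklore] -/
theorem fedM_rootPair_not_mem_specialUnitaryGroup [Nonempty n] (hN : 2 ≤ Fintype.card n)
    (h100 : 2 * Real.sin (Real.pi / Fintype.card n) ≤ 1 / 100) (h : 2 * Real.sin (Real.pi / Fintype.card n) < δ) :
    fedM δ (rootPair n) ∉ Matrix.specialUnitaryGroup n ℂ := by
  intro hmem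
  have hdet := (Matrix.mem_specialUnitaryGroup_iff.1 hmem).2
  rw [det_fedM_rootPair hN h100 h] at hdet
  norm_num at hdet

/-- The `SU(N)` inhabitant's guard excludes the root pair at every `N ≥ 2`: `δ_N ≤ 1/(3N) < 4/N ≤ 2 sin(π/N)`.
[folklore] -/
theorem rootPair_not_small_deltaFed [Nonempty n] (hN : 2 ≤ Fintype.card n) :
    ¬ ∀ i k : Fin 2, ‖rootPair n i * star (rootPair n k) - 1‖ < deltaFed n := by
  rw [rootPair_small_iff, not_lt]
  have hNr : (2 : ℝ) ≤ Fintype.card n := by exact_mod_cast hN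
  have hNpos : (0 : ℝ) < Fintype.card n := by linarith
  have hx0 : 0 ≤ Real.pi / Fintype.card n := by positivity
  have hx1 : Real.pi / Fintype.card n ≤ Real.pi / 2 := div_le_div_of_nonneg_left Real.pi_pos.le (by norm_num) hNr
  have hJ := Real.mul_le_sin hx0 hx1
  have h2 : 2 / Real.pi * (Real.pi / Fintype.card n) = 2 / Fintype.card n := by field_simp
  rw [h2] at hJ
  have hinv : 0 ≤ 1 / (Fintype.card n : ℝ) := by positivity
  calc deltaFed n ≤ 1 / (3 * Fintype.card n) := min_le_right _ _
    _ = (1 / 3) * (1 / Fintype.card n) := by ring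
    _ ≤ 4 * (1 / Fintype.card n) := by nlinarith
    _ = 2 * (2 / Fintype.card n) := by ring
    _ ≤ 2 * Real.sin (Real.pi / Fintype.card n) := by linarith

end RootPair

/-! ## 2b. The numeric threshold `N = 629` for the radius `1/100` -/

section Threshold

/-- For `N ≥ 629`: `2 sin(π/N) < 1/100` (`sin x < x`, `π < 3.141593`). [folklore] -/
theorem two_mul_sin_pi_div_lt {N : ℕ} (hN : 629 ≤ N) : 2 * Real.sin (Real.pi / N) < 1 / 100 := by
  have hNr : (629 : ℝ) ≤ N := by exact_mod_cast hN
  have hNpos : (0 : ℝ) < N := by linarith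
  have hx : 0 < Real.pi / N := by positivity
  have h1 : Real.sin (Real.pi / N) < Real.pi / N := Real.sin_lt hx
  have h2 : Real.pi / N ≤ Real.pi / 629 := div_le_div_of_nonneg_left Real.pi_pos.le (by norm_num) hNr
  have h3 : Real.pi / 629 < 1 / 200 := by
    have := Real.pi_lt_d6; linarith
  linarith

/-- For `2 ≤ N ≤ 628`: `1/100 < 2 sin(π/N)` (`sin` is monotone on `[0, π/2]`, `x − x³/6 < sin x`, `3.141592 < π`),
so `629` is the exact threshold. [folklore] -/
theorem lt_two_mul_sin_pi_div {N : ℕ} (h2 : 2 ≤ N) (h628 : N ≤ 628) : 1 / 100 < 2 * Real.sin (Real.pi / N) := by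
  have hNr : (2 : ℝ) ≤ N := by exact_mod_cast h2
  have hNr' : (N : ℝ) ≤ 628 := by exact_mod_cast h628
  have hNpos : (0 : ℝ) < N := by linarith
  set y : ℝ := Real.pi / 628 with hy
  have hpi1 := Real.pi_gt_d6
  have hpi2 := Real.pi_lt_d6
  have hy0 : 0 < y := by positivity
  have hy1 : 3.141592 / 628 < y := by rw [hy]; linarith
  have hy2 : y < 3.141593 / 628 := by rw [hy]; linarith
  -- monotonicity: `sin y ≤ sin (π/N)` since `y ≤ π/N ≤ π/2`
  have hle : y ≤ Real.pi / N := by rw [hy]; exact div_le_div_of_nonneg_left Real.pi_pos.le hNpos hNr'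
  have hx1 : Real.pi / N ≤ Real.pi / 2 := div_le_div_of_nonneg_left Real.pi_pos.le (by norm_num) hNr
  have hmono : Real.sin y ≤ Real.sin (Real.pi / N) :=
    Real.sin_le_sin_of_le_of_le_pi_div_two (by linarith [Real.pi_pos]) hx1 hle
  have hcube : y - y ^ 3 / 6 < Real.sin y := Real.sin_gt_sub_cube hy0
  have hy3 : y ^ 3 ≤ (3.141593 / 628) ^ 3 := by gcongr
  nlinarith

end Threshold

/-! ## 3. Group level: `federbushU` (radius `1/100`) maps an `SU(N)`-valued pair outside `SU(N)` for `N ≥ 629` -/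

section Group

variable {n : Type*} [Fintype n] [DecidableEq n] [Nonempty n]

/-- The root pair as a `U(N)`-family. [folklore] -/
def rootPairU (n : Type*) [Fintype n] [DecidableEq n] [Nonempty n] : Fin 2 → Matrix.unitaryGroup n ℂ :=
  fun j => ⟨rootPair n j, (Matrix.mem_specialUnitaryGroup_iff.1 (rootPair_mem_specialUnitaryGroup j)).1⟩

/-- Its matrices. [folklore] -/
@[simp] theorem coe_rootPairU (j : Fin 2) : ((rootPairU n j : Matrix.unitaryGroup n ℂ) : Matrix n n ℂ) = rootPair n j :=
  rfl

/-- **Every member of `rootPairU` is in `SU(N)`.** [folklore] -/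
theorem rootPairU_mem_specialUnitaryGroup (j : Fin 2) :
    ((rootPairU n j : Matrix.unitaryGroup n ℂ) : Matrix n n ℂ) ∈ Matrix.specialUnitaryGroup n ℂ :=
  rootPair_mem_specialUnitaryGroup j

/-- `FamilySmall δ rootPairU ⇔ 2 sin(π/N) < δ`. [folklore] -/
theorem familySmall_rootPairU_iff {δ : ℝ} :
    FamilySmall δ (rootPairU n) ↔ 2 * Real.sin (Real.pi / Fintype.card n) < δ :=
  (familySmall_U_iff (rootPairU n)).trans rootPair_small_iff

/-- **For `N ≥ 629` the pair is `1/100`-small**, i.e. inside `federbushU`'s guard. [folklore] -/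
theorem familySmall_federbushU_rootPairU (hN : 629 ≤ Fintype.card n) :
    FamilySmall (federbushU (n := n)).δ (rootPairU n) := by
  rw [federbushU_δ, familySmall_rootPairU_iff]; exact two_mul_sin_pi_div_lt hN

/-- **`federbushU` of the root pair is `e^{iπ/N}·1`** (`N ≥ 629`). [folklore] -/
theorem coe_federbushU_rootPairU (hN : 629 ≤ Fintype.card n) :
    (((federbushU (n := n)).M (rootPairU n) : Matrix.unitaryGroup n ℂ) : Matrix n n ℂ) = halfRoot n • 1 := by
  show fedM (1 / 100) (fun j => ((rootPairU n j : Matrix.unitaryGroup n ℂ) : Matrix n n ℂ)) = halfRoot n • 1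
  have hfun : (fun j => ((rootPairU n j : Matrix.unitaryGroup n ℂ) : Matrix n n ℂ)) = rootPair n := funext fun _ => rfl
  rw [hfun]
  exact fedM_rootPair (le_trans (by norm_num) hN) (two_mul_sin_pi_div_lt hN).le (two_mul_sin_pi_div_lt hN)

/-- **Its determinant is `−1`.** [folklore] -/
theorem det_federbushU_rootPairU (hN : 629 ≤ Fintype.card n) :
    ((((federbushU (n := n)).M (rootPairU n) : Matrix.unitaryGroup n ℂ) : Matrix n n ℂ)).det = -1 := by
  rw [coe_federbushU_rootPairU hN, Matrix.det_smul, Matrix.det_one, mul_one, halfRoot_pow_card]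

/-- **`federbushU` of the `SU(N)`-valued, `1/100`-small root pair is NOT in `SU(N)`** (`N ≥ 629`). [folklore] -/
theorem federbushU_rootPairU_not_mem (hN : 629 ≤ Fintype.card n) :
    (((federbushU (n := n)).M (rootPairU n) : Matrix.unitaryGroup n ℂ) : Matrix n n ℂ) ∉
      Matrix.specialUnitaryGroup n ℂ := by
  intro hmem
  have hdet := (Matrix.mem_specialUnitaryGroup_iff.1 hmem).2
  rw [det_federbushU_rootPairU hN] at hdet
  norm_num at hdet

/-- **NO `N`-UNIFORM RADIUS**: for every `N ≥ 629` the `U(N)`-inhabitant `federbushU` (radius `1/100`) has, inside its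
guard, an `SU(N)`-valued family whose average is outside `SU(N)`. [folklore] -/
theorem federbushU_not_specialUnitary_valued (hN : 629 ≤ Fintype.card n) :
    ∃ U : Fin 2 → Matrix.unitaryGroup n ℂ, FamilySmall (federbushU (n := n)).δ U ∧
      (∀ j, ((U j : Matrix.unitaryGroup n ℂ) : Matrix n n ℂ) ∈ Matrix.specialUnitaryGroup n ℂ) ∧
      (((federbushU (n := n)).M U : Matrix.unitaryGroup n ℂ) : Matrix n n ℂ) ∉ Matrix.specialUnitaryGroup n ℂ :=
  ⟨rootPairU n, familySmall_federbushU_rootPairU hN, rootPairU_mem_specialUnitaryGroup, federbushU_rootPairU_not_mem hN⟩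

/-- **THE TWO-SIDED RADIUS STATEMENT at the matrix level**: `fedM δ` is `SU(N)`-valued on ALL `SU(N)`-families
(every arity, every `N ≥ 1`) for `δ ≤ δ_N = min(1/100, 1/(3N))` (the tree's `fedM_mem_specialUnitaryGroup`), and for
`N ≥ 629` it is NOT at any radius `δ > 2 sin(π/N)` (the root pair; `2 sin(π/N) < 2π/N`). [folklore] -/
theorem two_sided_radius {δ : ℝ} :
    (δ ≤ deltaFed n → ∀ {m : ℕ} (U : Fin (m + 1) → Matrix n n ℂ), (∀ j, U j ∈ Matrix.specialUnitaryGroup n ℂ) →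
        fedM δ U ∈ Matrix.specialUnitaryGroup n ℂ) ∧
    (629 ≤ Fintype.card n → 2 * Real.sin (Real.pi / Fintype.card n) < δ →
        ∃ U : Fin 2 → Matrix n n ℂ, (∀ j, U j ∈ Matrix.specialUnitaryGroup n ℂ) ∧
          (∀ i k, ‖U i * star (U k) - 1‖ < δ) ∧ fedM δ U ∉ Matrix.specialUnitaryGroup n ℂ) := by
  refine ⟨fun hδ m U hU => ?_, fun hN h => ⟨rootPair n, rootPair_mem_specialUnitaryGroup, rootPair_small_iff.2 h,
    fedM_rootPair_not_mem_specialUnitaryGroup (le_trans (by norm_num) hN) (two_mul_sin_pi_div_lt hN).le h⟩⟩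
  have hc : (0 : ℝ) < Fintype.card n := Nat.cast_pos.mpr Fintype.card_pos
  exact fedM_mem_specialUnitaryGroup hU (hδ.trans deltaFed_le)
    ((mul_le_mul_of_nonneg_left hδ hc.le).trans card_mul_deltaFed_le)

end Group

/-! ## 4. (0.10) is `SL(N,ℂ)`-valued: `det (fedSol W) = 1` for `det W_j = 1`, radius `min(1/100, 1/(3N))` -/

section SL

variable {n : Type*} [Fintype n] [DecidableEq n]
variable {ι : Type*} [Fintype ι] [Nonempty ι]

/-- **(0.10) with `Gᶜ = SL(N,ℂ)` for `G = SU(N)`: the solution of `Σ_j log (W_j X) = 0` has DETERMINANT ONE** for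
every family of complex matrices with `det W_j = 1`, `‖W_j − 1‖ ≤ δ ≤ 1/100`, `N·δ ≤ 1/3` (so the average
`M = X⁻¹ U₀` of an `SL(N,ℂ)`-family is in `SL(N,ℂ)` — print's "the element U ∈ Gᶜ").  The numbers `z_j = tr log (W_j X)`
have equal exponentials `det W_j · det X = det X` and modulus `< π`, so they coincide; their sum is
`tr Σ_j log (W_j X) = 0`; hence `det X = e^0 = 1` — the argument of `BlockAveragingFederbush.det_fedSol_eq_one`, which
uses of its hypothesis `W_j ∈ SU(N)` only `det W_j = 1`. [cite: Balaban1987RG1, (0.10) p.253] -/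
theorem det_fedSol_eq_one_of_det_eq_one {δ : ℝ} (hδ : δ ≤ 1 / 100) (hδN : (Fintype.card n : ℝ) * δ ≤ 1 / 3)
    {W : ι → Matrix n n ℂ} (hWd : ∀ j, (W j).det = 1) (hW : ∀ j, ‖W j - 1‖ ≤ δ) :
    (fedSol W).det = 1 := by
  letI : NormedAlgebra ℚ (Matrix n n ℂ) := NormedAlgebra.restrictScalars ℚ ℂ _
  have hδ0 : 0 ≤ δ := (norm_nonneg _).trans (hW (Classical.arbitrary ι))
  have hW' : ∀ j, ‖W j - 1‖ ≤ 1 / 100 := fun j => (hW j).trans hδ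
  have hX : ‖fedSol W - 1‖ ≤ 3 * δ := norm_fedSol_sub_one_le hδ hW
  have hA : ∀ j, ‖W j * fedSol W - 1‖ ≤ 403 / 100 * δ := fun j =>
    (norm_mul_sub_one_le (hW j) hX).trans (by nlinarith)
  have hA1 : ∀ j, ‖W j * fedSol W - 1‖ < 1 := fun j => (hA j).trans_lt (by nlinarith)
  have hz : ∀ j, ‖(mlog (W j * fedSol W)).trace‖ < Real.pi := by
    intro j
    have h1 : ‖(mlog (W j * fedSol W)).trace‖ ≤ Fintype.card n * ‖mlog (W j * fedSol W)‖ := by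
      rcases isEmpty_or_nonempty n with hn | hn
      · simp [Matrix.trace]
      have hc : (0 : ℝ) < Fintype.card n := Nat.cast_pos.mpr Fintype.card_pos
      have h : ‖(mlog (W j * fedSol W)).trace / (Fintype.card n : ℂ)‖ ≤ ‖mlog (W j * fedSol W)‖ :=
        MatrixNorms.norm_ntr_le_opNorm _
      rw [norm_div, Complex.norm_natCast, div_le_iff₀ hc] at h
      linarith [mul_comm (Fintype.card n : ℝ) ‖mlog (W j * fedSol W)‖]
    have h2 : ‖mlog (W j * fedSol W)‖ ≤ 2 * ‖W j * fedSol W - 1‖ :=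
      norm_mlog_le_two_mul ((hA j).trans (by nlinarith))
    have hc : (0 : ℝ) ≤ Fintype.card n := Nat.cast_nonneg _
    have h3 : (Fintype.card n : ℝ) * ‖mlog (W j * fedSol W)‖ ≤ Fintype.card n * (2 * (403 / 100 * δ)) :=
      mul_le_mul_of_nonneg_left (h2.trans (by linarith [hA j])) hc
    have := Real.pi_gt_three
    nlinarith
  have hexp : ∀ j, Complex.exp (mlog (W j * fedSol W)).trace = (fedSol W).det := by
    intro j
    rw [Complex.exp_eq_exp_ℂ, ← det_exp_eq_exp_trace, exp_mlog (hA1 j), Matrix.det_mul, hWd j, one_mul]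
  set j₀ : ι := Classical.arbitrary ι
  have heq : ∀ j, (mlog (W j * fedSol W)).trace = (mlog (W j₀ * fedSol W)).trace := fun j =>
    cexp_inj_of_norm_lt_pi (by rw [hexp, hexp]) (hz j) (hz j₀)
  have hsum : ∑ j, (mlog (W j * fedSol W)).trace = 0 := by
    rw [← Matrix.trace_sum, sum_mlog_mul_fedSol hW', Matrix.trace_zero]
  have hz0 : (mlog (W j₀ * fedSol W)).trace = 0 := by
    simp only [heq, Finset.sum_const, Finset.card_univ, nsmul_eq_mul] at hsum
    exact (mul_eq_zero.1 hsum).resolve_left (Nat.cast_ne_zero.mpr Fintype.card_ne_zero)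
  rw [← hexp j₀, hz0, Complex.exp_zero]


end SL

end FederbushMean

end Literature.MathematicalPhysics.QuantumFieldTheory.Balaban1983to89
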